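import Summits.AtomisticToContinuum.Crystallization.Theorems.FrustratedLawDichotomyStrainedPatchHomHertzSup
import Summits.AtomisticToContinuum.Crystallization.Theorems.FrustratedLawDichotomyStrainedPatchHomXiElimL
import Summits.AtomisticToContinuum.Crystallization.Theorems.FrustratedLawDichotomyStrainedPatchHomCurvNearSplit
import Summits.AtomisticToContinuum.Crystallization.Theorems.FrustratedLawDichotomyStrainedPatchHomCurvLeafL2Smoke
import Summits.AtomisticToContinuum.Crystallization.Theorems.FrustratedLawDichotomyStrainedPatchHomForceHcp
import Summits.AtomisticToContinuum.Crystallization.Theorems.FrustratedLawDichotomyStrainedPatchHomEntryTableHcpV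

/-!
# The ξ-CONVEXITY VERDICT `entryLeafOKHC`: value at the box-centre shuffle + slope + CENTRED curvature ⟹ the hver energy disjunct on the whole box

decomp-a2c hand-1 g27 (crux `AperiodicFrustratedLawGap`, stmt-AtomisticToContinuum-27623; `(H) HomFloor (1/625)`, hcp half; lever (C), critic rows
1026 (C) / 1040 (b) / 1044).  A tree verdict is a function of ONE box `(c, w)` (entries × shuffle).  This verdict, for such a box:

* takes the REFERENCE box `(c, refW w)` = same entries × the single centre shuffle `ξ_c`;
* VALUE: the hcp vector-form table leaf `tableLeafOKHV qTableK1 tabE μ₀` on the reference box (pure energy floor `μ₀/SC` for every `U` of the box at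
  `ξ_c`, `…HomLeafTableCheckHcpV.leafCheckV_sound_hcp`), at the COMPUTED target `μ₀ = μ + cdiv(Gs², 2·lamS)`;
* SLOPE: `slopeCheck2` on the reference box at the COMPUTED `Gs = slopeGs` (the `ℓ¹` gradient bound the check compares against);
* CURVATURE: the centred leaf `curvCheckL2` on the whole box at the COMPUTED floor `lamS = curvLamS` (`…HomHertzSup`), labels = the in-kernel near
  list split into centred (`isCenL2`) ++ naive;
* the ball guard `xiBallOK` (`‖ξ‖ ≤ 1/4` on the box, hand-2 `…HomForceHcp`).

★★★ `entryLeafOKHC_sound` in the EXACT hver shape of `…HomForceHcp.entryLeafOKHX_sound` (energy disjunct), via `…HomXiElimL.hcpEnergy_of_xiElimL2`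
and the box-sum/near-sum bridge `…HomCurvNearSplit.boxSum_eq_nearSum`.  ★ `entryLeafOKHCX μ := entryLeafOKHC μ ∨ entryLeafOKHX μ` + soundness and
`hcpHalf_of_entryTreeHCX` (drop-in for the hcp ∃-tree fact over the enlarged verdict).

Kernel definitions + soundness; 0 sorry; standard axioms; no instances / notation / `#eval`.  `--supports stmt-AtomisticToContinuum-27623`.
-/

noncomputable section

namespace Summit.AtomisticToContinuum.Crystallization.Theorems.FrustratedLawDichotomyStrainedPatchHomCurvLeafL2

open scoped BigOperators RealInnerProductSpace
open Literature.Analysis.ValidatedNumerics.Numerics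
open Summit.AtomisticToContinuum.Crystallization.Theorems.ChargedEnergyGapNegative (E3)
open Summit.AtomisticToContinuum.Crystallization.Theorems.FrustratedLawDichotomySchurCut (effPot w₄₅ ω₄)
open Summit.AtomisticToContinuum.Crystallization.Theorems.FrustratedLawDichotomyAveragingRuleTightFree (TightNearCap BadNearCap)
open Summit.AtomisticToContinuum.Crystallization.Theorems.FrustratedLawDichotomyExemptAbsorption (ExemptNear)
open Summit.AtomisticToContinuum.Crystallization.Theorems.FrustratedLawDichotomyStrainedPatchHomSplit
open Summit.AtomisticToContinuum.Crystallization.Theorems.FrustratedLawDichotomyStrainedPatchHomEntryGram (entryFI mem_entryFI)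
open Summit.AtomisticToContinuum.Crystallization.Theorems.FrustratedLawDichotomyStrainedPatchHomEntryGramHcp (dot3 shufFI mem_dot3 mem_shufFI rootCH rootWH)
open Summit.AtomisticToContinuum.Crystallization.Theorems.FrustratedLawDichotomyStrainedPatchHomForceKit (vecB mem_vecB)
open Summit.AtomisticToContinuum.Crystallization.Theorems.FrustratedLawDichotomyStrainedPatchHomCurvCoeff (coeffFI2 mem_coeffFI2_beta)
open Summit.AtomisticToContinuum.Crystallization.Theorems.FrustratedLawDichotomyStrainedPatchHomCurvKit (accFI)
open Summit.AtomisticToContinuum.Crystallization.Theorems.FrustratedLawDichotomyStrainedPatchHomCurvLeaf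
  (slopeCheck2 nearLabels nearLabels_nodup nodup_filter_append boxSum_eq_nearSum toFinset_filter_append)
open Summit.AtomisticToContinuum.Crystallization.Theorems.FrustratedLawDichotomyStrainedPatchHomCurvLeafL (naiveK)
open Summit.AtomisticToContinuum.Crystallization.Theorems.FrustratedLawDichotomyStrainedPatchHomCurvCentreKit (cenShuf cenShuf_apply boxE)
open Summit.AtomisticToContinuum.Crystallization.Theorems.FrustratedLawDichotomyStrainedPatchHomForceHcp (xiBallOK norm_le_quarter_of_xiBallOK entryLeafOKHX entryLeafOKHX_sound)
open Summit.AtomisticToContinuum.Crystallization.Theorems.FrustratedLawDichotomyStrainedPatchHomLeafTableCheckHcpV (tableLeafOKHV leafCheckV_sound_hcp lvOf_mem)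
open Summit.AtomisticToContinuum.Crystallization.Theorems.FrustratedLawDichotomyStrainedPatchHomEntryTableHcp (abs_le_of_shufInOK sgnZ_two_natAbs)
open Summit.AtomisticToContinuum.Crystallization.Theorems.FrustratedLawDichotomyStrainedPatchHomLeafTableCheckHcp (tabSem_of_allOKK)
open Summit.AtomisticToContinuum.Crystallization.Theorems.FrustratedLawDichotomyStrainedPatchHomLeafTableCheck (qTableK1 qTableK1_allOKK tabE)
open Summit.AtomisticToContinuum.Crystallization.Theorems.FrustratedLawDichotomyStrainedPatchHomCertTree (CertTree treeOK)
open Summit.AtomisticToContinuum.Crystallization.Theorems.FrustratedLawDichotomyStrainedPatchHomEntryFlipHcp (HcpDich hcpHalf_of_entryTreeShuf)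

/-! ## §1. The computed slope constant and the reference box -/

/-- The reference box: same entries, zero shuffle width (the single centre shuffle `ξ_c`). -/
def refW (w : (Fin 3 × Fin 3) ⊕ Fin 3 → ℤ) : (Fin 3 × Fin 3) ⊕ Fin 3 → ℤ := Sum.elim (fun ab => w (Sum.inl ab)) (fun _ => 0)

/-- The `ℓ¹` gradient bound that `slopeCheck2 c w L ·` compares against (so the check passes at this value whenever the coefficient guard does). -/
def slopeGs (c w : (Fin 3 × Fin 3) ⊕ Fin 3 → ℤ) (L : List (Fin 3 → ℤ)) : ℤ :=
  ∑ i : Fin 3, (accFI L fun b => ((((coeffFI2 (dot3 (vecB (boxE c w) (shufFI c w) b) (vecB (boxE c w) (shufFI c w) b))).getD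
    (FI.ofInt 0, FI.ofInt 0)).2).mul (vecB (boxE c w) (shufFI c w) b i))).absHi

/-- `slopeCheck2` passes at the computed bound, given the coefficient guard. [formal bookkeeping] -/
theorem slopeCheck2_slopeGs {c w : (Fin 3 × Fin 3) ⊕ Fin 3 → ℤ} {L : List (Fin 3 → ℤ)} (hall : (L.all fun b => (naiveK c w b).isSome) = true) :
    slopeCheck2 c w L (slopeGs c w L) = true := by
  unfold slopeCheck2
  simp only [Bool.and_eq_true, decide_eq_true_eq]
  refine ⟨?_, le_of_eq ?_⟩
  · simpa [naiveK, boxE] using hall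
  · rfl

/-! ## §2. The verdict -/

/-- Centred ++ naive split of the near labels of the box. -/
def cenL (c w : (Fin 3 × Fin 3) ⊕ Fin 3 → ℤ) : List (Fin 3 → ℤ) := (nearLabels c w 2209 100).filter fun b => isCenL2 c w b
/-- Naive labels of the box. -/
def naiL (c w : (Fin 3 × Fin 3) ⊕ Fin 3 → ℤ) : List (Fin 3 → ℤ) := (nearLabels c w 2209 100).filter fun b => !isCenL2 c w b

/-- ★ **THE ξ-CONVEXITY VERDICT**: ball guard ∧ slope-coefficient guard on the reference box ∧ naive guard on the box ∧ (computed curvature floor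
`lamS > 0`) ∧ the table value leaf on the reference box at target `μ + cdiv(Gs², 2·lamS)`. -/
def entryLeafOKHC (μ : ℤ) (c w : (Fin 3 × Fin 3) ⊕ Fin 3 → ℤ) : Bool :=
  xiBallOK c w &&
  ((cenL c w ++ naiL c w).all fun b => (naiveK c (refW w) b).isSome) &&
  ((naiL c w).all fun b => (naiveK c w b).isSome) &&
  (match curvLamS c w (cenL c w) (naiL c w) with
    | none => false
    | some lamS => decide (0 < lamS) &&
        tableLeafOKHV qTableK1 tabE (μ + cdiv (slopeGs c (refW w) (cenL c w ++ naiL c w) ^ 2) (2 * lamS)) c (refW w))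

/-! ## §3. Soundness in the hver shape -/

/-- The centre shuffle lies in the reference box and in the box. [formal bookkeeping] -/
theorem cenShuf_mem_ref (c w : (Fin 3 × Fin 3) ⊕ Fin 3 → ℤ) (i : Fin 3) :
    |cenShuf c i - (c (Sum.inr i) : ℝ) / SC| ≤ ((refW w) (Sum.inr i) : ℝ) / SC := by
  rw [cenShuf_apply]; simp [refW]

/-- ★★★ **SOUNDNESS OF `entryLeafOKHC` IN THE hver SHAPE** (energy disjunct). [folklore chaining] -/
theorem entryLeafOKHC_sound {μ : ℤ} {c w : (Fin 3 × Fin 3) ⊕ Fin 3 → ℤ} (h : entryLeafOKHC μ c w = true) (U : E3 →L[ℝ] E3) (ξ : E3)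
    (_hsa : ∀ v v' : E3, ⟪U v, v'⟫ = ⟪v, U v'⟫) (hU : ‖U - 1‖ ≤ 1 / 4)
    (hbox : ∀ ab : Fin 3 × Fin 3, |(U (EuclideanSpace.single ab.2 (1 : ℝ))) ab.1 - (c (Sum.inl ab) : ℝ) / SC| ≤ (w (Sum.inl ab) : ℝ) / SC)
    (hξ : ∀ i : Fin 3, |ξ i - (c (Sum.inr i) : ℝ) / SC| ≤ (w (Sum.inr i) : ℝ) / SC) (_h0 : 0 ≤ ξ 0) (_h2 : 0 ≤ ξ 2) :
    (∀ (M : ℕ) (z : Fin M → E3) (cc : Fin M), Function.Injective z →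
        Set.range z = {x : E3 | dist x (z cc) ≤ 133 / 10 ∧ ∃ a : Fin 3 → ℤ,
          x = z cc + latPt U hexFrame a ∨ x = z cc + latPt U hexFrame a + U (hcpShift + ξ)} →
        TightNearCap (9 / 5) (3 / 2) z cc ∨ ExemptNear (9 / 5) ExRec z cc ∨ BadNearCap (9 / 5) (3 / 2) z cc) ∨
      (μ : ℝ) / SC ≤ ∑ b ∈ (Fintype.piFinset fun _ : Fin 3 => Finset.Icc (-7 : ℤ) 7).filter (fun b => b ≠ 0), effPot w₄₅ ω₄ (3 / 400) ‖latPt U hexFrame b‖ +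
        ∑ b ∈ (Fintype.piFinset fun _ : Fin 3 => Finset.Icc (-7 : ℤ) 7), effPot w₄₅ ω₄ (3 / 400) ‖latPt U hexFrame b + U (hcpShift + ξ)‖ := by
  classical
  refine Or.inr ?_
  have hS : (0 : ℝ) < SC := by norm_num [SC]
  unfold entryLeafOKHC at h
  simp only [Bool.and_eq_true] at h
  obtain ⟨⟨⟨hball, hrefall⟩, hnai⟩, hm⟩ := h
  cases hls : curvLamS c w (cenL c w) (naiL c w) with
  | none => rw [hls] at hm; exact absurd hm (by simp)
  | some lamS =>
  rw [hls] at hm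
  simp only [Bool.and_eq_true, decide_eq_true_eq] at hm
  obtain ⟨hlam, htab⟩ := hm
  set L := cenL c w ++ naiL c w with hLdef
  set Gs := slopeGs c (refW w) L with hGs
  set μ₀ := μ + cdiv (Gs ^ 2) (2 * lamS) with hμ₀
  -- the box has non-negative shuffle widths and lies in the ball
  have hw0 : ∀ i : Fin 3, (0 : ℝ) ≤ (w (Sum.inr i) : ℝ) / SC := fun i => (abs_nonneg _).trans (hξ i)
  have hξn : ‖ξ‖ ≤ 1 / 4 := norm_le_quarter_of_xiBallOK hball hξ
  have hξc : ∀ i : Fin 3, |cenShuf c i - (c (Sum.inr i) : ℝ) / SC| ≤ (w (Sum.inr i) : ℝ) / SC := fun i => by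
    rw [cenShuf_apply]; simpa using hw0 i
  have hξcn : ‖cenShuf c‖ ≤ 1 / 4 := norm_le_quarter_of_xiBallOK hball hξc
  -- labels
  have hLnd : L.Nodup := nodup_filter_append (nearLabels_nodup c w 2209 100) _
  have hLfin : L.toFinset = (nearLabels c w 2209 100).toFinset := toFinset_filter_append _ _
  have hcen : ((cenL c w).all fun b => labelOK2 c w b) = true := by
    rw [List.all_eq_true]
    intro b hb
    have := (List.mem_filter.1 hb).2
    simp only [isCenL2, Bool.and_eq_true] at this
    exact this.1
  -- the three certificates
  have hslope : slopeCheck2 c (refW w) L Gs = true := slopeCheck2_slopeGs hrefall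
  have hcurv : curvCheckL2 c w (cenL c w) (naiL c w) lamS = true := curvCheckL2_of_curvLamS hls hcen hnai
  -- the value floor at the centre shuffle, for every `U` of the box
  have hval : ∀ (U' : E3 →L[ℝ] E3) (ξ₀ : E3), ‖U' - 1‖ ≤ 1 / 4 →
      (∀ ab : Fin 3 × Fin 3, |(U' (EuclideanSpace.single ab.2 (1 : ℝ))) ab.1 - (c (Sum.inl ab) : ℝ) / SC| ≤ ((refW w) (Sum.inl ab) : ℝ) / SC) →
      (∀ i : Fin 3, |ξ₀ i - (c (Sum.inr i) : ℝ) / SC| ≤ ((refW w) (Sum.inr i) : ℝ) / SC) → ‖ξ₀‖ ≤ 1 / 4 →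
      (μ₀ : ℝ) / SC ≤ (∑ b ∈ (Fintype.piFinset fun _ : Fin 3 => Finset.Icc (-7 : ℤ) 7).filter (fun b => b ≠ 0), effPot w₄₅ ω₄ (3 / 400) ‖latPt U' hexFrame b‖) +
        ∑ b ∈ L.toFinset, effPot w₄₅ ω₄ (3 / 400) ‖latPt U' hexFrame b + U' (hcpShift + ξ₀)‖ := by
    intro U' ξ₀ hU' hbox' hξ₀' _
    simp only [tableLeafOKHV, Bool.and_eq_true] at htab
    obtain ⟨hin, hleaf⟩ := htab
    obtain ⟨hV, hη⟩ := lvOf_mem U' ξ₀ hbox' hξ₀'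
    have key := leafCheckV_sound_hcp (tabSem_of_allOKK qTableK1_allOKK) hleaf U' hU' ξ₀ (abs_le_of_shufInOK hin hξ₀') hV hη
    rw [sgnZ_two_natAbs] at key
    push_cast at key
    have e : 2 * (μ₀ : ℝ) / SC / 2 = (μ₀ : ℝ) / SC := by ring
    rw [e] at key
    -- box sum = near sum at `ξ₀` (ξ₀ lies in the box `(c, w)`)
    have hξ₀w : ∀ i : Fin 3, |ξ₀ i - (c (Sum.inr i) : ℝ) / SC| ≤ (w (Sum.inr i) : ℝ) / SC := fun i =>
      (hξ₀' i).trans (by simpa [refW] using hw0 i)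
    have hbox'' : ∀ ab : Fin 3 × Fin 3, |(U' (EuclideanSpace.single ab.2 (1 : ℝ))) ab.1 - (c (Sum.inl ab) : ℝ) / SC| ≤ (w (Sum.inl ab) : ℝ) / SC :=
      fun ab => by simpa [refW] using hbox' ab
    rw [boxSum_eq_nearSum (r2n := 2209) (r2d := 100) (by norm_num) (by norm_num) U' hbox'' ξ₀ hξ₀w, ← hLfin] at key
    exact key
  -- ξ-elimination on the box
  have hsame : ∀ ab : Fin 3 × Fin 3, c (Sum.inl ab) = c (Sum.inl ab) ∧ (refW w) (Sum.inl ab) = w (Sum.inl ab) := fun ab => ⟨rfl, rfl⟩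
  have hsub : ∀ (i : Fin 3) (x : ℝ), |x - (c (Sum.inr i) : ℝ) / SC| ≤ ((refW w) (Sum.inr i) : ℝ) / SC → |x - (c (Sum.inr i) : ℝ) / SC| ≤ (w (Sum.inr i) : ℝ) / SC :=
    fun i x hx => hx.trans (by simpa [refW] using hw0 i)
  have key := hcpEnergy_of_xiElimL2 hsame hsub hLnd hlam hslope hcurv
    (fun U' => ∑ b ∈ (Fintype.piFinset fun _ : Fin 3 => Finset.Icc (-7 : ℤ) 7).filter (fun b => b ≠ 0), effPot w₄₅ ω₄ (3 / 400) ‖latPt U' hexFrame b‖)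
    hval U hU hbox (cenShuf c) (cenShuf_mem_ref c w) hξcn ξ hξ hξn
  rw [hLfin, ← boxSum_eq_nearSum (r2n := 2209) (r2d := 100) (by norm_num) (by norm_num) U hbox ξ hξ] at key
  -- arithmetic: μ/SC ≤ μ₀/SC − (Gs/SC)²/(2·lamS/SC)
  have hlamR : (0 : ℝ) < lamS := by exact_mod_cast hlam
  have hcd := div_le_cdiv (a := Gs ^ 2) (b := 2 * lamS) (by positivity)
  push_cast at hcd
  have hμ : (μ : ℝ) / SC ≤ (μ₀ : ℝ) / SC - ((Gs : ℝ) / SC) ^ 2 / (2 * ((lamS : ℝ) / SC)) := by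
    rw [hμ₀]
    push_cast
    have e : ((Gs : ℝ) / SC) ^ 2 / (2 * ((lamS : ℝ) / SC)) = ((Gs : ℝ) ^ 2 / (2 * lamS)) / SC := by
      field_simp
    rw [e, ← sub_div, div_le_div_iff_of_pos_right hS]
    linarith
  exact hμ.trans key

/-! ## §4. The enlarged verdict and the hcp half -/

/-- ★ **hcp verdict with the ξ-convexity leaf**: `entryLeafOKHC μ ∨ entryLeafOKHX μ` (value/slope/curvature triple first, then hand-2's exempt
prune and the quick/table verdicts). -/
def entryLeafOKHCX (μ : ℤ) (c w : (Fin 3 × Fin 3) ⊕ Fin 3 → ℤ) : Bool := entryLeafOKHC μ c w || entryLeafOKHX μ c w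

/-- ★★ Soundness of `entryLeafOKHCX` in the hver shape. [folklore chaining] -/
theorem entryLeafOKHCX_sound {μ : ℤ} {c w : (Fin 3 × Fin 3) ⊕ Fin 3 → ℤ} (h : entryLeafOKHCX μ c w = true) (U : E3 →L[ℝ] E3) (ξ : E3)
    (hsa : ∀ v v' : E3, ⟪U v, v'⟫ = ⟪v, U v'⟫) (hU : ‖U - 1‖ ≤ 1 / 4)
    (hbox : ∀ ab : Fin 3 × Fin 3, |(U (EuclideanSpace.single ab.2 (1 : ℝ))) ab.1 - (c (Sum.inl ab) : ℝ) / SC| ≤ (w (Sum.inl ab) : ℝ) / SC)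
    (hξ : ∀ i : Fin 3, |ξ i - (c (Sum.inr i) : ℝ) / SC| ≤ (w (Sum.inr i) : ℝ) / SC) (h0 : 0 ≤ ξ 0) (h2 : 0 ≤ ξ 2) :
    (∀ (M : ℕ) (z : Fin M → E3) (cc : Fin M), Function.Injective z →
        Set.range z = {x : E3 | dist x (z cc) ≤ 133 / 10 ∧ ∃ a : Fin 3 → ℤ,
          x = z cc + latPt U hexFrame a ∨ x = z cc + latPt U hexFrame a + U (hcpShift + ξ)} →
        TightNearCap (9 / 5) (3 / 2) z cc ∨ ExemptNear (9 / 5) ExRec z cc ∨ BadNearCap (9 / 5) (3 / 2) z cc) ∨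
      (μ : ℝ) / SC ≤ ∑ b ∈ (Fintype.piFinset fun _ : Fin 3 => Finset.Icc (-7 : ℤ) 7).filter (fun b => b ≠ 0), effPot w₄₅ ω₄ (3 / 400) ‖latPt U hexFrame b‖ +
        ∑ b ∈ (Fintype.piFinset fun _ : Fin 3 => Finset.Icc (-7 : ℤ) 7), effPot w₄₅ ω₄ (3 / 400) ‖latPt U hexFrame b + U (hcpShift + ξ)‖ := by
  simp only [entryLeafOKHCX, Bool.or_eq_true] at h
  rcases h with h | h
  · exact entryLeafOKHC_sound h U ξ hsa hU hbox hξ h0 h2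
  · exact entryLeafOKHX_sound h U ξ hsa hU hbox hξ h0 h2

/-- ★★ The hcp half from ONE certificate tree over the enlarged verdict. [folklore chaining: `…HomEntryFlipHcp.hcpHalf_of_entryTreeShuf`] -/
theorem hcpHalf_of_entryTreeHCX {m : ℝ} {μ : ℤ} (hμ : 2 * (m + (-(7175 / 10000) + 3 / 400)) * SC ≤ μ) {t : CertTree ((Fin 3 × Fin 3) ⊕ Fin 3)}
    (h : treeOK (entryLeafOKHCX μ) t rootCH rootWH = true) :
    ∀ (U : E3 →L[ℝ] E3) (ξ : E3), (∀ v w : E3, inner ℝ (U v) w = inner ℝ v (U w)) → (∀ w : E3, 0 ≤ inner ℝ w (U w)) →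
      ‖U - 1‖ ≤ 1 / 4 → ‖ξ‖ ≤ 1 / 4 → HcpDich m U ξ :=
  hcpHalf_of_entryTreeShuf hμ (entryLeafOKHCX μ) (fun _ _ hv U ξ hsa hU hbox hξ h0 h2 => entryLeafOKHCX_sound hv U ξ hsa hU hbox hξ h0 h2) h

end Summit.AtomisticToContinuum.Crystallization.Theorems.FrustratedLawDichotomyStrainedPatchHomCurvLeafL2

end
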